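import Literature.Topology.FourManifolds.LatticeForms
import Mathlib.LinearAlgebra.Dimension.Localization
import Mathlib.RingTheory.Noetherian.Basic
import HarnessLib

/-!
# Sylvester's law of inertia on a lattice: `b⁺ + b⁻ = rank`
(discharge of `LinearMap.BilinForm.sigPos_add_sigNeg_eq_finrank` of `LatticeForms.lean`)

Trunk T-4MAN (`FourManifolds`); companion of `LatticeForms.lean` / `LatticeFormsProofs.lean`.

For a symmetric bilinear form `B` on a finitely generated module over a linearly ordered
commutative ring `R` (hence a domain of characteristic `0`, e.g. `ℤ`) which is nondegenerate in
the weak sense `(∀ y, B x y = 0) → x = 0`, the maximal rank `b⁺` of a positive definite submodule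
plus the maximal rank `b⁻` of a negative definite submodule is the rank of the module
(`LinearMap.BilinForm.sigPos_add_sigNeg_eq_finrank_of_isSymm`).  Classically (Serre, *A Course
in Arithmetic*, Ch. V §1.3.2: the index `τ(E) = r − s` of a unimodular lattice `E` is read off
from the signature `(r, s)` of `E ⊗ ℝ`, where `r + s = rank` by Sylvester's theorem for
nondegenerate real forms, Ch. IV §2.4; likewise Milnor–Husemoller, *Symmetric bilinear forms*
(1973), Ch. I §1 and Ch. II §2, the source of the named fact) this is obtained by base change
to `ℝ`; Mathlib has Sylvester's law only over ordered *fields*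
(`QuadraticForm.sigPos_add_sigNeg_add_radical`) and `sigPos` there is the maximal dimension of
a positive definite *subspace*, not sublattice.  We give a direct lattice proof, which never
leaves `R`:

* `b⁺ + b⁻ ≤ rank`: a positive definite and a negative definite submodule meet in `0`, and over a
  domain `rank s + rank t ≤ rank V` for submodules meeting in `0` (rank–nullity).
* `b⁺ + b⁻ ≥ rank` (**orthogonalisation inside the lattice**, `exists_orthogonal_of_isSymm`,
  following the inductive proof of Serre, Ch. IV §1.4, Thm. 1 "every quadratic module has an
  orthogonal basis" with denominators cleared): by induction on the rank there are `rank V` pairwise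
  `B`-orthogonal vectors `f i` with `B (f i) (f i) ≠ 0` — pick `x` with `B x x ≠ 0` (if
  `B x x = 0` for all `x` then `B = 0` by polarisation, `2` being a non-zero-divisor, so `V = 0`
  by nondegeneracy), pass to `ker (B x ·)`, which has rank `rank V − 1` (its quotient is the
  nonzero ideal `range (B x ·) ∋ B x x` of `R`, of rank `1`) and on which `B` is again
  nondegenerate (for `y ⊥ x` and any `z`, the vector `B x x • z − B x z • x` is `⊥ x` and pairs
  with `y` to `B x x * B y z`); the spans of the `f i` with `B (f i) (f i) > 0`, resp. `< 0`, are
  positive, resp. negative, definite (`B (Σ cᵢ fᵢ) (Σ cᵢ fᵢ) = Σ cᵢ² B (fᵢ, fᵢ)`) of ranks adding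
  up to `rank V` (orthogonal vectors of nonzero square are linearly independent).

The named fact `sigPos_add_sigNeg_eq_finrank` of `LatticeForms.lean` (unimodular symmetric forms
on lattices) is the special case `R = ℤ`: a perfect pairing has injective left adjoint
(`sigPos_add_sigNeg_eq_finrank_holds`).

## References

* J.-P. Serre, *A Course in Arithmetic*, GTM 7, Springer 1973: Ch. IV §1.4, Thm. 1 (every
  quadratic module over a field of characteristic `≠ 2` has an orthogonal basis; proof by
  splitting off a non-isotropic vector), Ch. IV §2.4 (signature `(r, s)`, `r + s = n`, of a
  nondegenerate real form of rank `n`), Ch. V §1.1 and §1.3.2 (unimodular lattices `E`, index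
  `τ(E) = r − s` from `E ⊗ ℝ`, `−r(E) ≤ τ(E) ≤ r(E)`). [Serre1973]
* J. Milnor, D. Husemoller, *Symmetric bilinear forms*, Springer 1973, Ch. I §1 and Ch. II §2
  (the signature of an inner product space over `ℤ`), as cited by the named fact. [MilnorHusemoller1973]
-/

section Sylvester

open Module

universe u v

namespace LinearMap.BilinForm

/-- Over a domain, two submodules of a finitely generated module meeting in `0` have
`rank s + rank t ≤ rank V` (rank–nullity, `Submodule.rank_sup_add_rank_inf_eq`; Mathlib's
`Submodule.finrank_add_finrank_le_of_disjoint` is the division-ring case).  Same statement as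
`Literature.Topology.FourManifolds.finrank_add_finrank_le_of_disjoint_of_isDomain` of
`Literature/Topology/FourManifolds/BordismFourProofs.lean`, which sits on top of the
singular-homology stack and is not imported into this algebra file (both are candidates for a
librarian hoist into `Literature/Algebra`). [folklore] -/
theorem finrank_add_finrank_le_of_disjoint_of_isDomain {R : Type v} [CommRing R] [IsDomain R]
    {V : Type u} [AddCommGroup V] [Module R V] [Module.Finite R V] {s t : Submodule R V}
    (h : Disjoint s t) : finrank R s + finrank R t ≤ finrank R V := by
  have key := Submodule.rank_sup_add_rank_inf_eq s t
  rw [h.eq_bot, rank_bot, add_zero] at key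
  have hle : Module.rank R s + Module.rank R t ≤ Module.rank R V := key ▸ Submodule.rank_le _
  have hV : Module.rank R V < Cardinal.aleph0 := Module.rank_lt_aleph0 R V
  have hs : Module.rank R s < Cardinal.aleph0 := (self_le_add_right _ _).trans hle |>.trans_lt hV
  have ht : Module.rank R t < Cardinal.aleph0 := (self_le_add_left _ _).trans hle |>.trans_lt hV
  have := Cardinal.toNat_le_toNat hle hV
  rwa [Cardinal.toNat_add hs ht] at this

variable {R : Type v} [CommRing R] [LinearOrder R] [IsStrictOrderedRing R]

/-- **`b⁺ + b⁻ ≤ rank`** for any quadratic form on a finitely generated module over a linearly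
ordered domain: a positive definite and a negative definite submodule meet in `0` (Serre,
*A Course in Arithmetic*, Ch. V §1.3.2: `−r(E) ≤ τ(E) ≤ r(E)`). [cite: Serre1973, Ch. V §1.3.2] -/
theorem sigPos_add_sigNeg_le_finrank {V : Type u} [AddCommGroup V] [Module R V]
    [Module.Finite R V] (Q : QuadraticForm R V) : sigPos Q + sigNeg Q ≤ finrank R V := by
  obtain ⟨P, hP, hpos⟩ := exists_finrank_eq_sigPos_and_posDef Q
  obtain ⟨N, hN, hneg⟩ := exists_finrank_eq_sigNeg_and_negDef Q
  rw [← hP, ← hN]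
  refine finrank_add_finrank_le_of_disjoint_of_isDomain ?_
  rw [Submodule.disjoint_def]
  intro v hvP hvN
  by_contra hv
  have h1 : 0 < Q v := by simpa using hpos ⟨v, hvP⟩ (by simpa using hv)
  have h2 : 0 < -Q v := by simpa using hneg ⟨v, hvN⟩ (by simpa using hv)
  exact lt_asymm h1 (neg_pos.mp h2)

/-- A symmetric bilinear form vanishing on the diagonal vanishes (polarisation: `2 B x y =
B (x+y) (x+y) − B x x − B y y`, and `2` is a non-zero-divisor in an ordered ring; Serre,
*A Course in Arithmetic*, Ch. IV §1.1, "if V is isotropic, all bases are orthogonal" in the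
proof of §1.4 Thm. 1). [folklore] -/
theorem apply_eq_zero_of_isSymm_of_apply_self_eq_zero {V : Type u} [AddCommGroup V] [Module R V]
    {B : LinearMap.BilinForm R V} (hB : B.IsSymm) (h0 : ∀ x, B x x = 0) (x y : V) :
    B x y = 0 := by
  have h := h0 (x + y)
  simp only [map_add, LinearMap.add_apply, h0 x, h0 y, zero_add, add_zero] at h
  have h2 : 2 * B x y = 0 := by
    rw [hB.eq y x] at h
    rwa [two_mul]
  exact (mul_eq_zero.mp h2).resolve_left two_ne_zero

/-- **Orthogonalisation inside a lattice.** A symmetric bilinear form on a finitely generated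
module `V` over a linearly ordered Noetherian domain which is nondegenerate
(`(∀ y, B x y = 0) → x = 0`) admits `rank V` pairwise orthogonal vectors of nonzero square:
the inductive proof of Serre, *A Course in Arithmetic*, Ch. IV §1.4, Thm. 1 ("every quadratic
module has an orthogonal basis": choose `e₁` with `e₁.e₁ ≠ 0`, pass to its orthogonal
hyperplane) followed verbatim with denominators cleared — split off `x` with `B x x ≠ 0` and
recurse on `ker (B x ·)`, on which `B` stays nondegenerate. The bound `n` only drives the
induction. [cite: Serre1973, Ch. IV §1.4 Thm. 1] -/
theorem exists_orthogonal_of_isSymm [IsNoetherianRing R] (n : ℕ) :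
    ∀ (V : Type u) [AddCommGroup V] [Module R V] [Module.Finite R V]
      (B : LinearMap.BilinForm R V), B.IsSymm → (∀ x, (∀ y, B x y = 0) → x = 0) →
      finrank R V ≤ n →
      ∃ (ι : Type) (_ : Fintype ι) (f : ι → V), Fintype.card ι = finrank R V ∧
        (∀ i, B (f i) (f i) ≠ 0) ∧ Pairwise fun i j => B (f i) (f j) = 0 := by
  induction n with
  | zero =>
    intro V _ _ _ B hB hnd hle
    exact ⟨PEmpty, inferInstance, fun i => i.elim, by simp; omega, fun i => i.elim,
      fun i => i.elim⟩
  | succ n ih =>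
    intro V _ _ _ B hB hnd hle
    by_cases h0 : ∃ x, B x x ≠ 0
    swap
    · -- `B = 0`, hence `V = 0`
      have h0' : ∀ x, B x x = 0 := fun x => by
        by_contra h
        exact h0 ⟨x, h⟩
      have hV : ∀ x : V, x = 0 := fun x =>
        hnd x fun y => apply_eq_zero_of_isSymm_of_apply_self_eq_zero hB h0' x y
      haveI : Subsingleton V := ⟨fun a b => by rw [hV a, hV b]⟩
      exact ⟨PEmpty, inferInstance, fun i => i.elim, by simp [Module.finrank_zero_of_subsingleton],
        fun i => i.elim, fun i => i.elim⟩
    · obtain ⟨x, hx⟩ := h0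
      haveI : IsNoetherian R V := isNoetherian_of_isNoetherianRing_of_finite R V
      -- split off `x`, recurse on `L = x^⊥ = ker (B x ·)`
      set L : Submodule R V := LinearMap.ker (B x) with hL
      have hrange : finrank R ↥(LinearMap.range (B x)) = 1 := by
        apply le_antisymm
        · calc finrank R ↥(LinearMap.range (B x)) ≤ finrank R R := Submodule.finrank_le _
            _ = 1 := Module.finrank_self R
        · have hli : LinearIndependent R ![(⟨B x x, LinearMap.mem_range_self _ _⟩ :
              ↥(LinearMap.range (B x)))] := by
            rw [Fintype.linearIndependent_iff]
            intro c hc i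
            fin_cases i
            have h1 := congrArg Subtype.val hc
            simp only [Fin.sum_univ_one, Matrix.cons_val_zero, SetLike.val_smul, smul_eq_mul,
              ZeroMemClass.coe_zero, mul_eq_zero] at h1
            exact h1.resolve_right hx
          simpa using hli.fintype_card_le_finrank
      have hrank : finrank R L + 1 = finrank R V := by
        have h1 := Submodule.finrank_quotient_add_finrank L
        rw [(LinearMap.quotKerEquivRange (B x)).finrank_eq, hrange] at h1
        omega
      have hnd' : ∀ y : L, (∀ z : L, B.restrict L y z = 0) → y = 0 := by
        intro y hy
        have hyx : B x y = 0 := LinearMap.mem_ker.mp y.2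
        ext
        refine hnd y fun z => ?_
        have hz' : B x x • z - B x z • x ∈ L := by
          rw [hL, LinearMap.mem_ker, map_sub, map_smul, map_smul, smul_eq_mul, smul_eq_mul,
            mul_comm (B x z) (B x x), sub_self]
        have key : B (y : V) (B x x • z - B x z • x) = 0 := hy ⟨_, hz'⟩
        rw [map_sub, map_smul, map_smul, smul_eq_mul, smul_eq_mul,
          hB.eq (y : V) x, hyx, mul_zero, sub_zero] at key
        exact (mul_eq_zero.mp key).resolve_left hx
      obtain ⟨ι, _, f, hcard, hsq, horth⟩ := ih L (B.restrict L) (hB.restrict L) hnd' (by omega)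
      refine ⟨Option ι, inferInstance, fun o => o.elim x fun i => (f i : V), ?_, ?_, ?_⟩
      · rw [Fintype.card_option, hcard, hrank]
      · rintro (_ | i)
        · exact hx
        · exact hsq i
      · rintro (_ | i) (_ | j) hij
        · exact absurd rfl hij
        · exact LinearMap.mem_ker.mp (f j).2
        · change B (f i : V) x = 0
          rw [hB.eq]
          exact LinearMap.mem_ker.mp (f i).2
        · have hij' : i ≠ j := fun h => hij (congrArg some h)
          exact horth hij'

/-- The span of the members of positive square of a pairwise orthogonal family is positive
definite (`B (Σ cᵢ fᵢ) (Σ cᵢ fᵢ) = Σ cᵢ² B (fᵢ, fᵢ)`), of rank their number (orthogonal vectors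
of nonzero square are linearly independent over a domain); hence that number is at most `b⁺`
(Serre, *A Course in Arithmetic*, Ch. IV §2.4: in an orthogonal basis the form is
`Σ aᵢ Xᵢ²`, and `r` counts the positive `aᵢ`). [cite: Serre1973, Ch. IV §2.4] -/
theorem card_pos_le_sigPos {V : Type u} [AddCommGroup V] [Module R V] [Module.Finite R V]
    (B : LinearMap.BilinForm R V) {ι : Type*} [Fintype ι] (f : ι → V)
    (horth : Pairwise fun i j => B (f i) (f j) = 0) :
    Fintype.card {i // 0 < B (f i) (f i)} ≤ sigPos B.toQuadraticMap := by
  classical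
  set g : {i // 0 < B (f i) (f i)} → V := fun i => f i with hg
  have horth' : Pairwise fun i j : {i // 0 < B (f i) (f i)} => B (g i) (g j) = 0 :=
    fun i j hij => horth fun e => hij (Subtype.ext e)
  -- orthogonal vectors of nonzero square are linearly independent (over a domain)
  have hli : LinearIndependent R g := by
    rw [Fintype.linearIndependent_iff]
    intro c hc i
    have h := congrArg (fun v => B v (g i)) hc
    simp only [map_sum, map_smul, LinearMap.sum_apply, LinearMap.smul_apply, smul_eq_mul,
      map_zero, LinearMap.zero_apply] at h
    rw [Finset.sum_eq_single i (fun j _ hji => by rw [horth' hji, mul_zero])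
      (fun hi => absurd (Finset.mem_univ i) hi)] at h
    exact (mul_eq_zero.mp h).resolve_right (ne_of_gt i.2)
  -- the span is positive definite: `B (Σ cᵢ gᵢ) (Σ cᵢ gᵢ) = Σ cᵢ² B (gᵢ, gᵢ)`
  have hP : (B.toQuadraticMap.restrict (Submodule.span R (Set.range g))).PosDef := by
    intro v hv
    obtain ⟨c, hc⟩ := (Submodule.mem_span_range_iff_exists_fun R).mp v.2
    have key : B.toQuadraticMap (v : V) = ∑ i, c i * c i * B (g i) (g i) := by
      rw [LinearMap.BilinMap.toQuadraticMap_apply, ← hc]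
      simp only [map_sum, map_smul, LinearMap.sum_apply, LinearMap.smul_apply, smul_eq_mul]
      refine Finset.sum_congr rfl fun i _ => ?_
      rw [Finset.mul_sum, Finset.sum_eq_single i (fun j _ hji => by rw [horth' hji]; ring)
        (fun hi => absurd (Finset.mem_univ i) hi)]
      ring
    have hne : ∃ i, c i ≠ 0 := by
      by_contra h
      have hc0 : ∀ i, c i = 0 := fun i => by
        by_contra hi
        exact h ⟨i, hi⟩
      apply hv
      ext
      rw [← hc]
      simp [hc0]
    obtain ⟨i₀, hi₀⟩ := hne
    change 0 < B.toQuadraticMap (v : V)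
    rw [key]
    exact Finset.sum_pos' (fun i _ => mul_nonneg (mul_self_nonneg _) (le_of_lt i.2))
      ⟨i₀, Finset.mem_univ _, mul_pos (mul_self_pos.mpr hi₀) i₀.2⟩
  calc Fintype.card {i // 0 < B (f i) (f i)}
      = finrank R ↥(Submodule.span R (Set.range g)) := (finrank_span_eq_card hli).symm
    _ ≤ sigPos B.toQuadraticMap := le_sigPos_of_posDef _ hP

/-- **Sylvester's law of inertia on a lattice, `b⁺ + b⁻ = rank`.** For a symmetric bilinear
form on a finitely generated module over a linearly ordered domain (e.g. a lattice over `ℤ`)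
which is nondegenerate in the weak sense `(∀ y, B x y = 0) → x = 0` (in particular for a
unimodular form, or any form nondegenerate over the fraction field), the maximal ranks of
positive and of negative definite submodules add up to the rank (Serre, *A Course in
Arithmetic*, Ch. IV §2.4 with Ch. V §1.3.2, and Milnor–Husemoller 1973, Ch. I §1 and Ch. II
§2, via Sylvester's theorem over `ℝ`; proved here by orthogonalisation inside the lattice,
`exists_orthogonal_of_isSymm`). [cite: Serre1973, Ch. IV §2.4 and Ch. V §1.3.2] -/
theorem sigPos_add_sigNeg_eq_finrank_of_isSymm [IsNoetherianRing R] {V : Type u} [AddCommGroup V]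
    [Module R V] [Module.Finite R V] (B : LinearMap.BilinForm R V) (hB : B.IsSymm)
    (hnd : ∀ x, (∀ y, B x y = 0) → x = 0) :
    sigPos B.toQuadraticMap + sigNeg B.toQuadraticMap = finrank R V := by
  refine le_antisymm (sigPos_add_sigNeg_le_finrank _) ?_
  obtain ⟨ι, _, f, hcard, hsq, horth⟩ := exists_orthogonal_of_isSymm _ V B hB hnd le_rfl
  have hp := card_pos_le_sigPos B f horth
  have hn := card_pos_le_sigPos (-B) f fun i j hij => by
    show (-B) (f i) (f j) = 0
    rw [LinearMap.neg_apply, LinearMap.neg_apply, horth hij, neg_zero]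
  rw [show (-B).toQuadraticMap = -B.toQuadraticMap from rfl, sigPos_neg] at hn
  -- every `B (f i) (f i)` is `> 0` or `< 0`
  have hsplit : Fintype.card {i // 0 < B (f i) (f i)} +
      Fintype.card {i // 0 < (-B) (f i) (f i)} = Fintype.card ι := by
    have e : {i // 0 < (-B) (f i) (f i)} ≃ {i // ¬ 0 < B (f i) (f i)} :=
      Equiv.subtypeEquivRight fun i => by
        rw [LinearMap.neg_apply, LinearMap.neg_apply, neg_pos, not_lt]
        exact ⟨le_of_lt, fun h => lt_of_le_of_ne h (hsq i)⟩
    rw [Fintype.card_congr e, Fintype.card_subtype_compl]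
    have := Fintype.card_subtype_le fun i => 0 < B (f i) (f i)
    omega
  omega

end LinearMap.BilinForm

end Sylvester

namespace LinearMap.BilinForm

variable {V : Type*} [AddCommGroup V] [Module ℤ V] (Q : LinearMap.BilinForm ℤ V)

/-- **Discharge** of the named fact `sigPos_add_sigNeg_eq_finrank` (`LatticeForms.lean`): for a
symmetric unimodular form on a lattice, `b⁺ + b⁻ = rank` (Milnor–Husemoller 1973, Ch. I §1 and
Ch. II §2; Serre, *A Course in Arithmetic*, Ch. V §1.3.2 with Ch. IV §2.4).  A unimodular form
is a perfect pairing, so its left adjoint is injective, which is the nondegeneracy used by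
`sigPos_add_sigNeg_eq_finrank_of_isSymm`; freeness is not needed.
[cite: MilnorHusemoller1973, Ch. I §1 and Ch. II §2] [cite: Serre1973, Ch. V §1.3.2] -/
theorem sigPos_add_sigNeg_eq_finrank_holds : Q.sigPos_add_sigNeg_eq_finrank := by
  intro _ _ hu hs
  refine sigPos_add_sigNeg_eq_finrank_of_isSymm Q hs fun x hx => ?_
  haveI : Q.IsPerfPair := hu
  refine (LinearMap.IsPerfPair.bijective_left Q).1 ?_
  rw [map_zero]
  exact LinearMap.ext hx

end LinearMap.BilinForm
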